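import Literature.Analysis.FluidPDE.OnsagerBDSVStressSplit
import Literature.Analysis.FluidPDE.OnsagerBDSVEnergy
import HarnessLib

/-!
# The BDSV transport error (§6.1.2) split along `w_{q+1} = w_o + w_c`

Buckmaster–De Lellis–Székelyhidi–Vicol (BDSV), *Onsager's conjecture for admissible weak
solutions*, CPAM 72 (2019) = arXiv:1701.08678, §6.1.2, estimate the transport error of the new
Reynolds stress, `ℛ(∂ₜ w_{q+1} + v̄_q·∇ w_{q+1}) = ℛ(D_{t,q} w_{q+1})`, `D_{t,q} = ∂ₜ + v̄_q·∇`
(the named fact `BDSV.transportErrorEstimate` of `OnsagerBDSVStressSplit.lean`), starting from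

> "We split the transport error into two parts
> `(∂ₜ + v̄_q·∇) w_{q+1} = (∂ₜ + v̄_q·∇) w_o + (∂ₜ + v̄_q·∇) w_c`."

The first part is expanded by the Lie-advection identity arXiv (5.18) into the two mode sums of
arXiv (6.6), `Σ_{i,k} (∇v̄_q)ᵀ(∇Φ_i)⁻¹ b_{i,k} e^{iλ_{q+1}k·Φ_i} + Σ_{i,k} d_{i,k} e^{iλ_{q+1}k·Φ_i}`,
each mode being fed to the stationary phase estimate Prop. C.2 (arXiv (6.7)) with the amplitude
bounds of Props. 5.7, 5.9 and Lemma 5.4; the second part is `Σ_{i,k} (D_{t,q} c_{i,k}) e^{iλ_{q+1}k·Φ_i}`,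
estimated through Prop. C.2 and Prop. 5.9 (arXiv (5.39)); "summing over `k ≠ 0` we reach the
inequality (6.8) `‖ℛ(∂ₜw_{q+1} + v̄_q·∇w_{q+1})‖_α ≲ δ_{q+1}^{1/2} δ_q^{1/2} λ_q / λ_{q+1}^{1-3α}`".

This file performs the first split for the honest objects of the tree — the principal part
`w_o = BDSV.principalPart` (arXiv (5.17)) and the corrector `w_c = w_{q+1} - w_o = BDSV.correctorPart`
of `OnsagerBDSVEnergy.lean`, the material derivative `D_{t,q} = BDSV.advectiveDeriv S.T S.vbar`
(one-sided time derivative within `[0,T]`, as in `BDSV.transportSource`), `ℛ = Torus.antidivergence`: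

* the two sources `BDSV.principalTransportSource = D_{t,q} w_o` and
  `BDSV.correctorTransportSource = D_{t,q} w_c`, with
  `D_{t,q} w_{q+1} = D_{t,q} w_o + D_{t,q} w_c` on `[0,T]` (`BDSV.SmoothData.transportSource_eq_add`:
  additivity of `D_{t,q}` on jointly smooth fields, `BDSV.advectiveDeriv_add_apply`) and hence
  `ℛ(D_{t,q} w_{q+1}) = ℛ(D_{t,q} w_o) + ℛ(D_{t,q} w_c)` on `[0,T]`
  (`BDSV.SmoothData.antidivergence_transportSource_eq_add`, linearity of `ℛ` on smooth fields);
* the common SHAPE of the printed estimates as a predicate on source terms,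
  `BDSV.TransportBound F` ("`‖ℛ F(t)‖_{C^{0,α}} ≤ C δ_{q+1}^{1/2} δ_q^{1/2} λ_q λ_{q+1}^{-(1-4α)}` for
  `t ∈ [0,T]`", a body for the prefix `BDSV.StageFact` of `OnsagerBDSVEnergy.lean`), with
  `BDSV.transportErrorEstimate ↔ StageFact (TransportBound transportSource)` by `Iff.rfl`. The
  scale is that of Prop. 6.1 (6.1), exactly as the three error facts of
  `OnsagerBDSVStressSplit.lean` are transcribed ("Design choices" there): the printed displays of
  §6.1.2 end with `λ_{q+1}^{-(1-α)}` (first sum of (6.6)), `λ_{q+1}^{-(1-4α)}` (the `d_{i,k}` sum) and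
  `λ_{q+1}^{-(1-3α)}` (the corrector), tacitly absorbing factors `λ_q^{O(α)} ≤ λ_{q+1}^{O(α)}`; the
  exponent of (6.1) is the uniform-in-`q` content of each display and is what §6.1.4 uses;
* the PROVED assembly `BDSV.transportErrorEstimate_of_parts`: the stage facts with bodies
  `TransportBound principalTransportSource` (the part `D_{t,q} w_o`: arXiv (6.6)–(6.7), the display
  following (6.7) and the display for `d_{i,k}`) and `TransportBound correctorTransportSource`
  (the part `D_{t,q} w_c`: the display for `D_{t,q} c_{i,k}`, Prop. 5.9 (5.39)) imply
  `BDSV.transportErrorEstimate`. Its ingredients: the conjunction of stage facts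
  (`BDSV.StageFact.and`), the bounds `δ_{q+1}/(8λ_q^α) ≤ ρ_q ≤ δ_{q+1}` of Lemma 5.4 along the prefix
  (`BDSV.stageFact_rhoQ_bounds`, which make `ρ_q > 0` and the construction smooth,
  `BDSV.PerturbationHypotheses.toSmoothData`), the split of `ℛ(D_{t,q} w_{q+1})` above and the
  triangle inequality for `‖·‖_{C^{0,α}}` (`Torus.eContDiffHolderNorm_add_le`); the constant is
  `2 max(C, 0)`. No named fact is introduced: the two part-estimates enter as hypotheses, to be
  proved in later files.

## What is not here

The proofs of the two hypotheses of the assembly. For `D_{t,q} w_o`: the aggregate form of the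
Lie-advection identity (5.18)/(6.6), `D_{t,q} w_o = (w_o·∇)v̄_q + Σ_i adj(∇Φ_i) 𝔇_i` with
`𝔇_i = (D_{t,q} ρ_{q,i}^{1/2}) W(R̃_{q,i}, λ_{q+1}Φ_i) + ρ_{q,i}^{1/2} (∂_R W)(R̃_{q,i}, λ_{q+1}Φ_i)[D_{t,q} R̃_{q,i}]`
(using `D_{t,q} Φ_i = 0`, `D_{t,q} ∇Φ_i = -∇Φ_i ∇v̄_q`, `det ∇Φ_i = 1`), the Fourier expansion of
`W` in `ξ` with the coefficient decay arXiv (5.5), Prop. C.2 (`BDSV.antidivergencePhaseBound`,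
`OnsagerBDSVStationaryPhase.lean`) mode by mode, Props. 5.7, 5.9 (arXiv (5.23)–(5.25), (5.37)–(5.38);
cf. `OnsagerBDSVDeformationBounds.lean`), Lemma 5.4 (arXiv (5.11)–(5.15)), the choice of `N` and
the parameter inequalities of `OnsagerBDSVStressParams.lean`, and the summation over `k ≠ 0` and
`i`. For `D_{t,q} w_c`: the explicit form of `w_c` (the terms of
`n⁻¹ curl Z` in which the derivative falls on the slow variables), `D_{t,q} w_c = Σ (D_{t,q} c_{i,k}) e^{iλ_{q+1}k·Φ_i}`,
Prop. C.2 and Prop. 5.9 (arXiv (5.39)). Each is the subject of later files, after which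
`BDSV.transportErrorEstimate_holds` follows from `BDSV.transportErrorEstimate_of_parts`.

## References

* T. Buckmaster, C. De Lellis, L. Székelyhidi Jr., V. Vicol, *Onsager's conjecture for admissible
  weak solutions*, Comm. Pure Appl. Math. 72 (2019) 229–274 = arXiv:1701.08678, §6.1.2
  (arXiv (6.6)–(6.8)), §5.3 (arXiv (5.17)–(5.18), (5.20)), §5.5 Props. 5.7, 5.9, Lemma 5.4, App. C
  Prop. C.2; Prop. 6.1 (6.1) and §6.1.4. Equation numbers as in arXiv:1701.08678v1
  (cf. `OnsagerBDSVStressSplit.lean`, "Numbering").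
-/

open MeasureTheory Set
open scoped NNReal ENNReal ContDiff Matrix Matrix.Norms.Elementwise

noncomputable section

namespace Literature.Analysis.FluidPDE

namespace BDSV

open FunctionSpaces FunctionSpaces.Torus

/-- The flat three-torus `T³ = (ℝ/ℤ)³`, local notation. -/
local notation "𝕋³" => UnitAddTorus (Fin 3)

/-- Euclidean `ℝ³`, local notation. -/
local notation "ℝ³" => EuclideanSpace ℝ (Fin 3)

/-! ## Additivity of the material derivative -/

section Advective

variable {F : Type*} [NormedAddCommGroup F] [NormedSpace ℝ F] {T : ℝ} {u : ℝ → 𝕋³ → ℝ³}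
  {f g : ℝ → 𝕋³ → F}

/-- **`D_t (f + g) = D_t f + D_t g` on `[0,T]`** for jointly smooth fields `f, g` (`T > 0`): the
one-sided time derivative within `[0,T]` and the convective derivative `(u·∇)` are additive on
smooth slices. [folklore] -/
theorem advectiveDeriv_add_apply (hT : 0 < T) (hf : IsSmoothSpaceTimeOn (Icc 0 T) f)
    (hg : IsSmoothSpaceTimeOn (Icc 0 T) g) {t : ℝ} (ht : t ∈ Icc 0 T) (x : 𝕋³) :
    advectiveDeriv T u (fun s y => f s y + g s y) t x =
      advectiveDeriv T u f t x + advectiveDeriv T u g t x := by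
  have h1 : timeDerivWithin (Icc 0 T) (fun s y => f s y + g s y) t x =
      timeDerivWithin (Icc 0 T) f t x + timeDerivWithin (Icc 0 T) g t x :=
    timeDerivWithin_add hf hg (uniqueDiffOn_Icc hT) ht x
  have hf1 : IsContDiff 1 (f t) := (hf.isSmooth_slice ht).isContDiff (by simp)
  have hg1 : IsContDiff 1 (g t) := (hg.isSmooth_slice ht).isContDiff (by simp)
  have h2 : convect (u t) (fun y => f t y + g t y) x =
      convect (u t) (f t) x + convect (u t) (g t) x := by
    simp only [convect]
    rw [show (fun y => f t y + g t y) = f t + g t from rfl, Torus.fderiv_add hf1 hg1]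
    rfl
  simp only [advectiveDeriv, h1, h2]
  abel

end Advective

/-! ## The two parts `D_{t,q} w_o`, `D_{t,q} w_c` of the transport term -/

section Sources

variable (P : Params) (S : Setting)

/-- **The material derivative of the principal part**, `D_{t,q} w_o = ∂ₜ w_o + (v̄_q·∇) w_o`
(§6.1.2: the first part of the split of the transport term; expanded in arXiv (6.6)), for
`w_o = BDSV.principalPart` (arXiv (5.17)) and the one-sided time derivative within `[0,T]`.
[cite: BuckmasterEtAl2018, §6.1.2 (split of the transport error; arXiv (6.6))] -/
def principalTransportSource (𝔚 : MikadoDatum mikadoRadius) (η : ℕ → ℝ → 𝕋³ → ℝ)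
    (D : ℕ → ℝ → 𝕋³ → ℝ³) : ℝ → 𝕋³ → ℝ³ :=
  advectiveDeriv S.T S.vbar (principalPart P S 𝔚 η D)

/-- **The material derivative of the corrector**, `D_{t,q} w_c = ∂ₜ w_c + (v̄_q·∇) w_c`
(§6.1.2: the second part of the split, "the term involving the material derivative of the
correction", `= Σ_{i,k} (D_{t,q} c_{i,k}) e^{iλ_{q+1}k·Φ_i}`), for `w_c = BDSV.correctorPart`.
[cite: BuckmasterEtAl2018, §6.1.2 (split of the transport error; the term D_{t,q} w_c)] -/
def correctorTransportSource (𝔚 : MikadoDatum mikadoRadius) (η : ℕ → ℝ → 𝕋³ → ℝ)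
    (D : ℕ → ℝ → 𝕋³ → ℝ³) : ℝ → 𝕋³ → ℝ³ :=
  advectiveDeriv S.T S.vbar (correctorPart P S 𝔚 η D)

end Sources

/-! ## The shape of the estimates of §6.1.2 -/

section Body

/-- **The common shape of the transport-error bounds of §6.1.2**, as a body for the prefix
`BDSV.StageFact`: for a source term `F = F(P, S, 𝔚, η, D) : [0,T] × T³ → ℝ³` (one of
`D_{t,q} w_{q+1}`, `D_{t,q} w_o`, `D_{t,q} w_c`), the spatial `C^{0,α}` norm of `ℛ F(t)` is at most
`C δ_{q+1}^{1/2} δ_q^{1/2} λ_q λ_{q+1}^{-(1-4α)}` for every `t ∈ [0,T]` (`BDSV.HolderSupLE … 0 α`, the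
scale of Prop. 6.1 (6.1), cf. `BDSV.transportErrorEstimate`). A predicate on source terms, not a
statement. [cite: BuckmasterEtAl2018, §6.1.2 (arXiv (6.8)) with Prop. 6.1 (6.1)] -/
def TransportBound
    (F : (P : Params) → (S : Setting) → MikadoDatum mikadoRadius → (ℕ → ℝ → 𝕋³ → ℝ) →
      (ℕ → ℝ → 𝕋³ → ℝ³) → ℝ → 𝕋³ → ℝ³)
    (𝔚 : MikadoDatum mikadoRadius) (P : Params) (C : ℝ) (S : Setting) (c₀ : ℝ) (Cη : ℕ → ℕ → ℝ)
    (𝒟 : PerturbationData P S c₀ Cη) : Prop :=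
  HolderSupLE S.T (fun t => Torus.antidivergence (F P S 𝔚 𝒟.cut.η 𝒟.D t)) 0 (Real.toNNReal P.α)
    (C * (Real.sqrt (amp P.β P.a P.b (S.q + 1)) * Real.sqrt (amp P.β P.a P.b S.q) *
      freq P.a P.b S.q * freq P.a P.b (S.q + 1) ^ (-1 + 4 * P.α)))

/-- The transport-error body is monotone in the constant (the scale is nonnegative for `a ≥ 1`).
[folklore] -/
theorem TransportBound.mono
    {F : (P : Params) → (S : Setting) → MikadoDatum mikadoRadius → (ℕ → ℝ → 𝕋³ → ℝ) →
      (ℕ → ℝ → 𝕋³ → ℝ³) → ℝ → 𝕋³ → ℝ³}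
    {𝔚 : MikadoDatum mikadoRadius} {P : Params} {C C' : ℝ} {S : Setting} {c₀ : ℝ}
    {Cη : ℕ → ℕ → ℝ} {𝒟 : PerturbationData P S c₀ Cη} (ha : 1 ≤ P.a) (hC : C ≤ C')
    (h : TransportBound F 𝔚 P C S c₀ Cη 𝒟) : TransportBound F 𝔚 P C' S c₀ Cη 𝒟 :=
  HolderSupLE.mono h (mul_le_mul_of_nonneg_right hC (stressScale_nonneg ha S.q))

end Body

/-! ## Splitting the transport term -/

section Split

variable {P : Params} {S : Setting} {η : ℕ → ℝ → 𝕋³ → ℝ} {D : ℕ → ℝ → 𝕋³ → ℝ³}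

namespace SmoothData

variable (h : SmoothData P S η D)
include h

/-- `D_{t,q} w_o` is jointly smooth on `[0,T] × T³`. [folklore] -/
theorem principalTransportSource (𝔚 : MikadoDatum mikadoRadius) :
    IsSmoothSpaceTimeOn (Icc 0 S.T) (BDSV.principalTransportSource P S 𝔚 η D) :=
  ((h.principalPart 𝔚).timeDerivWithin h.uniqueDiffOn).add
    (h.vbar.convect (h.principalPart 𝔚) h.uniqueDiffOn)

/-- `D_{t,q} w_c` is jointly smooth on `[0,T] × T³`. [folklore] -/
theorem correctorTransportSource (𝔚 : MikadoDatum mikadoRadius) :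
    IsSmoothSpaceTimeOn (Icc 0 S.T) (BDSV.correctorTransportSource P S 𝔚 η D) :=
  ((h.correctorPart 𝔚).timeDerivWithin h.uniqueDiffOn).add
    (h.vbar.convect (h.correctorPart 𝔚) h.uniqueDiffOn)

/-- **The split of the transport term** (§6.1.2, first display): on `[0,T]`,
`D_{t,q} w_{q+1} = D_{t,q} w_o + D_{t,q} w_c` for `w_{q+1} = w_o + w_c`.
[cite: BuckmasterEtAl2018, §6.1.2 (split of the transport error)] -/
theorem transportSource_eq_add (𝔚 : MikadoDatum mikadoRadius) {t : ℝ} (ht : t ∈ Icc 0 S.T)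
    (x : 𝕋³) :
    BDSV.transportSource P S 𝔚 η D t x =
      BDSV.principalTransportSource P S 𝔚 η D t x + BDSV.correctorTransportSource P S 𝔚 η D t x := by
  have hw : BDSV.perturbation P S 𝔚 η D =
      fun s y => BDSV.principalPart P S 𝔚 η D s y + BDSV.correctorPart P S 𝔚 η D s y := by
    funext s y
    exact perturbation_eq_principalPart_add_correctorPart P S 𝔚 η D s y
  rw [transportSource_eq_advectiveDeriv, hw]
  exact advectiveDeriv_add_apply h.pos_T (h.principalPart 𝔚) (h.correctorPart 𝔚) ht x

/-- **`ℛ(D_{t,q} w_{q+1}) = ℛ(D_{t,q} w_o) + ℛ(D_{t,q} w_c)` on `[0,T]`** (linearity of `ℛ` on the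
smooth slices of the two parts). [cite: BuckmasterEtAl2018, §6.1.2 (split of the transport error)] -/
theorem antidivergence_transportSource_eq_add (𝔚 : MikadoDatum mikadoRadius) {t : ℝ}
    (ht : t ∈ Icc 0 S.T) :
    Torus.antidivergence (BDSV.transportSource P S 𝔚 η D t) =
      Torus.antidivergence (BDSV.principalTransportSource P S 𝔚 η D t) +
        Torus.antidivergence (BDSV.correctorTransportSource P S 𝔚 η D t) := by
  have h1 := (h.principalTransportSource 𝔚).isSmooth_slice ht
  have h2 := (h.correctorTransportSource 𝔚).isSmooth_slice ht
  have hF : BDSV.transportSource P S 𝔚 η D t =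
      BDSV.principalTransportSource P S 𝔚 η D t + BDSV.correctorTransportSource P S 𝔚 η D t := by
    funext y
    rw [Pi.add_apply]
    exact h.transportSource_eq_add 𝔚 ht y
  rw [hF, Torus.antidivergence_add h1 h2]

end SmoothData

end Split

/-! ## Assembly -/

section Assembly

/-- `BDSV.transportErrorEstimate` is the stage fact with the transport-error body for the full
transport term `D_{t,q} w_{q+1}` (`BDSV.transportSource`), definitionally.
[cite: BuckmasterEtAl2018, §6.1.2 (arXiv (6.8))] -/
theorem transportErrorEstimate_iff_stageFact :
    transportErrorEstimate ↔ StageFact (TransportBound transportSource) :=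
  Iff.rfl

/-- **Assembly of the transport error estimate from its two parts** (BDSV §6.1.2: the estimate
(6.8) of `ℛ(D_{t,q} w_{q+1})` is obtained as the sum of the estimates of `ℛ(D_{t,q} w_o)` — arXiv
(6.6)–(6.7) and the `d_{i,k}` display — and of `ℛ(D_{t,q} w_c)` — the `D_{t,q} c_{i,k}` display):
if the transport-error body holds along the common prefix for `D_{t,q} w_o`
(`BDSV.principalTransportSource`) and for `D_{t,q} w_c` (`BDSV.correctorTransportSource`), then
`BDSV.transportErrorEstimate` holds. The thresholds are the extremal ones of the two hypotheses
together with `α < βb(b-1)` and the threshold of `BDSV.stageFact_rhoQ_bounds` (which make `ρ_q > 0`,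
so that the construction is smooth and `ℛ` splits the transport term); the constant is
`2 max(C, 0)`. [cite: BuckmasterEtAl2018, §6.1.2 (arXiv (6.6)–(6.8))] -/
theorem transportErrorEstimate_of_parts
    (h₁ : StageFact (TransportBound principalTransportSource))
    (h₂ : StageFact (TransportBound correctorTransportSource)) : transportErrorEstimate := by
  rw [transportErrorEstimate_iff_stageFact]
  -- the two estimates and the bounds on `ρ_q`, along one prefix
  have h₁₂ := StageFact.and h₁ h₂
    (fun 𝔚 P C C' S c₀ Cη 𝒟 ha hC h => h.mono ha hC)
    (fun 𝔚 P C C' S c₀ Cη 𝒟 ha hC h => h.mono ha hC)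
  have h := StageFact.and h₁₂ stageFact_rhoQ_bounds
    (fun 𝔚 P C C' S c₀ Cη 𝒟 ha hC h => ⟨h.1.mono ha hC, h.2.mono ha hC⟩)
    (fun _ _ _ _ _ _ _ _ _ _ h => h)
  refine StageFact.mono (fun C => 2 * max C 0) ?_ h
  intro 𝔚 P C S c₀ Cη 𝒟 hc₀ _ _ _ _ ha hH hb
  obtain ⟨⟨e₁, e₂⟩, hρ⟩ := hb
  obtain ⟨Nbar, Cin, C₀, H⟩ := hH
  have ha1 : 1 ≤ P.a := ha.le
  -- `ρ_q > 0`, hence the construction is smooth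
  have hρpos : ∀ t ∈ Icc 0 S.T, 0 < rhoQ P S t := fun t ht =>
    lt_of_lt_of_le (div_pos (mul_pos (amp_pos ha1 _) (Real.rpow_pos_of_pos (freq_pos ha1 _) _))
      (by norm_num)) (hρ t ht).1
  have hsm : SmoothData P S 𝒟.cut.η 𝒟.D := H.toSmoothData hc₀ 𝒟 hρpos
  -- bookkeeping of the scale
  set s : ℝ := Real.sqrt (amp P.β P.a P.b (S.q + 1)) * Real.sqrt (amp P.β P.a P.b S.q) *
    freq P.a P.b S.q * freq P.a P.b (S.q + 1) ^ (-1 + 4 * P.α) with hs_def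
  have hs : 0 ≤ s := stressScale_nonneg ha1 S.q
  have hle : C * s ≤ max C 0 * s := mul_le_mul_of_nonneg_right (le_max_left _ _) hs
  have hm : 0 ≤ max C 0 * s := mul_nonneg (le_max_right _ _) hs
  intro t ht
  have h1 := (hsm.principalTransportSource 𝔚).isSmooth_slice ht
  have h2 := (hsm.correctorTransportSource 𝔚).isSmooth_slice ht
  change Torus.eContDiffHolderNorm 0 (Real.toNNReal P.α)
      (Torus.antidivergence (transportSource P S 𝔚 𝒟.cut.η 𝒟.D t)) ≤
    ENNReal.ofReal (2 * max C 0 * s)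
  rw [hsm.antidivergence_transportSource_eq_add 𝔚 ht]
  calc Torus.eContDiffHolderNorm 0 (Real.toNNReal P.α)
        (Torus.antidivergence (principalTransportSource P S 𝔚 𝒟.cut.η 𝒟.D t) +
          Torus.antidivergence (correctorTransportSource P S 𝔚 𝒟.cut.η 𝒟.D t))
      ≤ Torus.eContDiffHolderNorm 0 (Real.toNNReal P.α)
          (Torus.antidivergence (principalTransportSource P S 𝔚 𝒟.cut.η 𝒟.D t)) +
        Torus.eContDiffHolderNorm 0 (Real.toNNReal P.α)
          (Torus.antidivergence (correctorTransportSource P S 𝔚 𝒟.cut.η 𝒟.D t)) :=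
      Torus.eContDiffHolderNorm_add_le ((Torus.isSmooth_antidivergence h1).isContDiff (by simp))
        ((Torus.isSmooth_antidivergence h2).isContDiff (by simp))
    _ ≤ ENNReal.ofReal (C * s) + ENNReal.ofReal (C * s) := add_le_add (e₁ t ht) (e₂ t ht)
    _ ≤ ENNReal.ofReal (max C 0 * s) + ENNReal.ofReal (max C 0 * s) :=
      add_le_add (ENNReal.ofReal_le_ofReal hle) (ENNReal.ofReal_le_ofReal hle)
    _ = ENNReal.ofReal (max C 0 * s + max C 0 * s) := (ENNReal.ofReal_add hm hm).symm
    _ = ENNReal.ofReal (2 * max C 0 * s) := by ring_nf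

end Assembly

end BDSV

end Literature.Analysis.FluidPDE
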